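import Literature.Geometry.Lorentzian.KerrSchild
import Literature.Geometry.Lorentzian.KerrWaveDecay
import HarnessLib

/-!
# `KerrRadiusFarTube`: the Kerr–Schild radius is comparable along translates
(crux `GapExhaustion`, stmt-FinalStateConjecture-10808, line photon-shell-pseudoconvexity;
registered stub `stub_kerrRadiusFarTube` of the far chain of the conditional Killing sweep,
lead c12 wave 4, far brick F6)

The far part of the node's Killing sweep works in coordinate balls of radius `~ r(x)/4` around far
points `x` of the Kerr–Schild cylinders `{r = c}` and needs the Kerr–Schild radius
`r = Kerr.radius a` (the nonnegative root of `r⁴ − (ρ² − a²) r² − a² x₃² = 0`, `ρ = ‖x⃗‖`,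
Visser arXiv:0706.0622, (35)) to stay comparable along them. The tool is the elementary two-sided
comparison

  `|r(z + w) − r(z)| ≤ ‖w‖ + |a|`   (`kerrTube_abs_radius_add_sub_le`),

whence, for `|a| ≤ M`, `r(z) − ‖w‖ − M ≤ r(z + w) ≤ r(z) + ‖w‖ + M` (`stub_kerrRadiusFarTube`).
It follows from the sandwich `ρ − |a| ≤ r ≤ ρ`, i.e. `|r − ρ| ≤ |a|`
(`kerrTube_abs_radius_sub_spatialNorm_le`), of the radius between the spatial radius and its
shift by the spin — `r ≤ ρ` is the tree's `Kerr.radius_le_spatialNorm` (`KerrWaveDecay.lean`),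
`ρ − |a| ≤ r` comes from `ρ² − a² ≤ r²` (`Kerr.spatialNorm_sq_sub_sq_le_radius_sq`,
`KerrWaveEnergy.lean`) — and the `1`-Lipschitz bound `|ρ(z + w) − ρ(z)| ≤ ‖w⃗‖ ≤ ‖w‖` of the
spatial radius (`kerrTube_abs_spatialNorm_add_sub_le`; the spatial part `E4.spatial` is a linear
map of norm at most one).

## References

* M. Visser, *The Kerr spacetime: a brief introduction*, arXiv:0706.0622, (35). [arXiv07060622]
* R. P. Kerr, A. Schild, *A new class of vacuum solutions of the Einstein field equations* (1965),
  §2. [KerrSchild1965]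
-/

noncomputable section

-- D-0017: single-problem summit, `Summit.<S>.<S>.…` by design (cf. lakefile `weak.linter.dupNamespace`).
set_option linter.dupNamespace false

namespace Summit.FinalStateConjecture.FinalStateConjecture.Theorems

open Literature.Geometry.Lorentzian

/-- `‖x⃗‖ ≤ ‖x‖`: the spatial radius of a point of `E4` is at most its Euclidean norm
(`‖x‖² = (x⁰)² + ‖x⃗‖²`). Local copy of `E4.spatialNorm_le_norm` of
`KerrSchildEnergyEstimate.lean`, which is outside this file's import cone. [folklore] -/
private theorem kerrTube_spatialNorm_le_norm (x : E4) : E4.spatialNorm x ≤ ‖x‖ := by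
  have hs : 0 ≤ E4.spatialNorm x := E4.spatialNorm_nonneg x
  have hsq : ‖x‖ ^ 2 = x 0 ^ 2 + E4.spatialNorm x ^ 2 := by
    rw [EuclideanSpace.real_norm_sq_eq, Fin.sum_univ_four, E4.spatialNorm_sq]
    ring
  rw [← sq_le_sq₀ hs (norm_nonneg x), hsq]
  exact le_add_of_nonneg_left (sq_nonneg _)

/-- **The spatial radius is `1`-Lipschitz**: `|ρ(z + w) − ρ(z)| ≤ ‖w‖` for `ρ = ‖·⃗‖` the
Euclidean norm of the spatial part `(x¹, x², x³)` of a point of `E4` (reverse triangle inequality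
for the linear spatial projection `E4.spatial`, then `‖w⃗‖ ≤ ‖w‖`). [folklore] -/
theorem kerrTube_abs_spatialNorm_add_sub_le (z w : E4) :
    |E4.spatialNorm (z + w) - E4.spatialNorm z| ≤ ‖w‖ := by
  have h := abs_norm_sub_norm_le (E4.spatial (z + w)) (E4.spatial z)
  rw [← map_sub, add_sub_cancel_left] at h
  exact h.trans (kerrTube_spatialNorm_le_norm w)

/-- Lower comparison of the Kerr–Schild radius with the spatial radius: `ρ − |a| ≤ r` for
`r = Kerr.radius a x`, `ρ = ‖x⃗‖`. From `ρ² − a² ≤ r²` (Visser arXiv:0706.0622, (35):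
`r² = ((ρ² − a²) + √((ρ² − a²)² + 4a²z²))/2` and `√(⋯) ≥ |ρ² − a²|`) and `r, |a| ≥ 0`:
`ρ² ≤ r² + a² ≤ (r + |a|)²`. Local copy of `KerrLeafSojourn.spatialNorm_sub_le_radius`
(`SwallowTheDatumKerrShieldedSettlesStubKerrLeafSojournAux1.lean`), whose module lies far outside
this brick's import cone; the reusable public form is `kerrTube_abs_radius_sub_spatialNorm_le`
below. [cite: arXiv07060622, (35)] -/
private theorem kerrTube_spatialNorm_sub_abs_le_radius (a : ℝ) (x : E4) :
    E4.spatialNorm x - |a| ≤ Kerr.radius a x := by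
  have h := Kerr.spatialNorm_sq_sub_sq_le_radius_sq a x
  have hr := Kerr.radius_nonneg a x
  have ha := abs_nonneg a
  have hs := E4.spatialNorm_nonneg x
  have hle : E4.spatialNorm x ≤ Kerr.radius a x + |a| := by
    rw [← sq_le_sq₀ hs (add_nonneg hr ha)]
    nlinarith [sq_abs a, mul_nonneg hr ha]
  linarith

/-- **Sandwich of the Kerr–Schild radius by the spatial radius**: `|r − ρ| ≤ |a|` for
`r = Kerr.radius a x`, `ρ = ‖x⃗‖`, at every point of `E4` — i.e. `ρ − |a| ≤ r ≤ ρ`: the upper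
bound is the tree's `Kerr.radius_le_spatialNorm` (`r² (r² − ρ²) = a² (z² − r²) ≤ a² (ρ² − r²)` from
the defining quartic), the lower one `ρ² − a² ≤ r² ⇒ ρ ≤ r + |a|` (Visser arXiv:0706.0622, (35):
`r² = ρ² − a² sin²θ` off the junk disc). [cite: arXiv07060622, (35)] -/
theorem kerrTube_abs_radius_sub_spatialNorm_le (a : ℝ) (x : E4) :
    |Kerr.radius a x - E4.spatialNorm x| ≤ |a| := by
  have h1 := Kerr.radius_le_spatialNorm a x
  have h2 := kerrTube_spatialNorm_sub_abs_le_radius a x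
  rw [abs_le]
  constructor <;> linarith [abs_nonneg a]

/-- **The Kerr–Schild radius is comparable along translates**:
`|r(z + w) − r(z)| ≤ ‖w‖ + |a|` for all `z w : E4` (all of `E4`, junk disc included). Chain
`r(z + w) ≤ ρ(z + w) ≤ ρ(z) + ‖w‖ ≤ r(z) + |a| + ‖w‖` and
`r(z + w) ≥ ρ(z + w) − |a| ≥ ρ(z) − ‖w‖ − |a| ≥ r(z) − ‖w‖ − |a|`, using `ρ − |a| ≤ r ≤ ρ`
(Visser arXiv:0706.0622, (35); `Kerr.radius_le_spatialNorm`,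
`kerrTube_spatialNorm_sub_abs_le_radius`) and the `1`-Lipschitz bound
`kerrTube_abs_spatialNorm_add_sub_le`. [cite: arXiv07060622, (35)] -/
theorem kerrTube_abs_radius_add_sub_le (a : ℝ) (z w : E4) :
    |Kerr.radius a (z + w) - Kerr.radius a z| ≤ ‖w‖ + |a| := by
  have h1 := Kerr.radius_le_spatialNorm a (z + w)
  have h2 := Kerr.radius_le_spatialNorm a z
  have h3 := kerrTube_spatialNorm_sub_abs_le_radius a (z + w)
  have h4 := kerrTube_spatialNorm_sub_abs_le_radius a z
  have h5 := abs_le.1 (kerrTube_abs_spatialNorm_add_sub_le z w)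
  rw [abs_le]
  constructor <;> linarith [h5.1, h5.2]

/-- **Far tube comparison of the Kerr–Schild radius** (registered stub `stub_kerrRadiusFarTube` of
line photon-shell-pseudoconvexity, crux `GapExhaustion`; far chain F6): for `|a| ≤ M` and all
`z w : E4`, `r(z) − ‖w‖ − M ≤ r(z + w) ≤ r(z) + ‖w‖ + M`, i.e. `|r(z + w) − r(z)| ≤ ‖w‖ + M`.
Immediate from `|r(z + w) − r(z)| ≤ ‖w‖ + |a|` (`kerrTube_abs_radius_add_sub_le`: the sandwich
`ρ − |a| ≤ r ≤ ρ` of Visser arXiv:0706.0622, (35), and the `1`-Lipschitz spatial radius `ρ`).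
[cite: arXiv07060622, (35)] -/
theorem stub_kerrRadiusFarTube : ∀ (M a : ℝ) (z w : E4), |a| ≤ M → Kerr.radius a z - ‖w‖ - M ≤ Kerr.radius a (z + w) ∧ Kerr.radius a (z + w) ≤ Kerr.radius a z + ‖w‖ + M := by
  intro M a z w haM
  have h := abs_le.1 (kerrTube_abs_radius_add_sub_le a z w)
  constructor <;> linarith [h.1, h.2]

end Summit.FinalStateConjecture.FinalStateConjecture.Theorems

end
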